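import Literature.NumberTheory.GaloisRepresentations.IdeleBarKSMaps
import HarnessLib

/-!
# `E_S → I_S` is injective: an `S`-unit whose truncated principal idèle is trivial is `1`
# (Harari, *Galois Cohomology and CFT*, Lemma 15.39 (proof), §17.4 (17.1) — left exactness)

Topic `NumberTheory/GaloisRepresentations`; namespaces `Literature.NumberTheory.GaloisRepresentations.IdeleHerbrand` (§1)
and `Literature.NumberTheory.GaloisRepresentations.IdeleClassBar` (§2); sequel to `IdeleBarKSMaps.lean`
(`unitsToTruncKS : E_{K_S} → I_S`).  Theorems only; NO named fact, no `sorry`, no instance, no notation; number fields in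
`Type`.

THE POINT.  Harari's `i : 𝒪_{F,S}^* → J_{F,S}` ("`J_{F,S} ∩ (F^*·U_{F,S}) = i(𝒪_{F,S}^*)`", Lemma 15.39) is injective
because the truncation keeps the archimedean components, on which a principal idèle `(a)` reads `a` diagonally; hence
the first map of (17.1) `0 → E_S → I_S → C_S → 0` is a monomorphism.  Here: `(a)^{(S)} = 1 ⇒ a = 1` at a finite layer
(§1) and the injectivity of `unitsToTruncKS K S : E_{K_S} → I_S` on vectors (§2).

## What is formalised

* §1 `IdeleHerbrand.eq_one_of_truncOf_principal_eq_one` (`(a)^{(S)} = 1 → a = 1`), `truncOf_principal_injective`.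
* §2 **`IdeleClassBar.unitsToTruncKS_injective : Function.Injective (unitsToTruncKS K S).hom`**.

Written for lane «PT-Ш-S-TC» (brick D3) of crux `GoodLatticeBDPValue` (cell bsd-eis, item 19032), seat bsd-line-x1-p1-w6
gen 10.  HONEST FRAMING: bookkeeping; no arithmetic statement and no case of BSD is proved here.

## References
* D. Harari, *Galois Cohomology and Class Field Theory*, Universitext, Springer (2020), Lemma 15.39, §17.4 (17.1).
  [Harari2020]
-/

noncomputable section

open NumberField IsDedekindDomain CategoryTheory
open Field (absoluteGaloisGroup)
open Literature.NumberTheory.Automorphic Literature.Algebra.Homology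
open scoped Classical

namespace Literature.NumberTheory.GaloisRepresentations

/-! ## §1. `(a)^{(S)} = 1 ⇒ a = 1` -/

namespace IdeleHerbrand

variable {F : Type} [Field F] [NumberField F] {E : Type} [Field E] [NumberField E] [Algebra F E]
variable (S : Finset (HeightOneSpectrum (𝓞 F)))

omit [NumberField F] in
/-- **`(a)^{(S)} = 1 ⇒ a = 1`**: the truncation keeps the archimedean part of the principal idèle `(a)`, which is `a`
diagonally in `∏_{v ∣ ∞} E_v`, and `E → ∏_{v ∣ ∞} E_v` is injective. [cite: Harari2020, Lemma 15.39 (proof)] -/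
theorem eq_one_of_truncOf_principal_eq_one {a : Eˣ} (h : truncOf S (principal E a) = 1) : a = 1 := by
  have h1 := congrArg (fun x : ideleGroup E => (x : AdeleRing (𝓞 E) E).1) h
  have h2 : algebraMap E (InfiniteAdeleRing E) (a : E) = 1 := h1
  exact Units.ext ((algebraMap E (InfiniteAdeleRing E)).injective (h2.trans (map_one _).symm))

omit [NumberField F] in
/-- **`a ↦ (a)^{(S)}` is injective on `Eˣ`.** [cite: Harari2020, Lemma 15.39 (proof)] -/
theorem truncOf_principal_injective : Function.Injective fun a : Eˣ => truncOf S (principal E a) := by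
  have hmon : Function.Injective ((truncMonoidHom F E S).comp (principal E)) :=
    (injective_iff_map_eq_one _).2 fun a ha => eq_one_of_truncOf_principal_eq_one S ha
  exact hmon

end IdeleHerbrand

/-! ## §2. `E_{K_S} → I_S` is injective -/

namespace IdeleClassBar

variable (K : Type) [Field K] [NumberField K] (S : Finset (HeightOneSpectrum (𝓞 K)))

/-- **Harari's `E_S → I_S` is injective** (left exactness of (17.1)): on a layer `E`, `[(a)^{(S)}]_E = 0` forces
`(a)^{(S)} = 1` (`of_injective`), hence `a = 1`. [cite: Harari2020, §17.4 (17.1), Lemma 15.39 (proof)] -/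
theorem unitsToTruncKS_injective : Function.Injective (unitsToTruncKS K S).hom := by
  refine (injective_iff_map_eq_zero _).2 fun u hu => ?_
  have hu' : truncKSAddHom K S ((unitsToIdelesKS K S).hom u) = 0 := hu
  have h1 := congrArg Subtype.val hu'
  rw [coe_truncKSAddHom_apply, coe_unitsToIdelesKS_apply] at h1
  obtain ⟨E, x, hx⟩ := (unitsData K).toSystem.exists_of (u.1 : (unitsData K).toSystem.limit)
  haveI := E.numberField
  rw [← hx, GalLayerData.Hom.limitMap_of, truncBar_of] at h1
  have h2 : (truncHomData K S).app E ((unitsToIdele K).app E x) = 0 :=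
    (ideleData K).toSystem.of_injective E (h1.trans (map_zero _).symm)
  have h3 : IdeleHerbrand.truncOf S (IdeleHerbrand.principal E.1 (Additive.toMul x : (E.1)ˣ)) = 1 :=
    congrArg Additive.toMul h2
  have h4 : x = 0 := Additive.toMul.injective (IdeleHerbrand.eq_one_of_truncOf_principal_eq_one S h3)
  apply Subtype.ext
  change (u.1 : (unitsData K).toSystem.limit) = 0
  rw [← hx, h4, map_zero]
  rfl

end IdeleClassBar

end Literature.NumberTheory.GaloisRepresentations

end
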